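import Mathlib
import HarnessLib
import Summits.HubbardSuperconductivity.HubbardSuperconductivity.Theorems.KLProgrammeKLRegimeTwoVolumeDualReadoutRows
import Summits.HubbardSuperconductivity.HubbardSuperconductivity.Theorems.KLProgrammeKLRegimeSplitTwoLegCounterVertex
import Literature.MathematicalPhysics.QuantumLattice.HubbardGridCounterQuadratic
import Literature.Probability.LatticeModels.TorusCentredLift

/-!
# Route `KLProgramme` — crux K3 ENGINE (stmt-HubbardSuperconductivity-20437), stub (e) proof-input «(e)-D-ROWS», keying (A′), REKEY-D file D11T-s:
# THE COUNTERTERM SEAM OF THE READ-OUT VANISHES — two-volume invariance of the frame's position kernel under the centred lift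
# (seat hubbard-kl-k3c4-p1 g28; discharges the named hypotheses `hSeamP/hSeamM` of ✓ D11T `…TwoVolumeLipDoubledTruncReadout.hPc_of_truncReadout` with `Seam = 0`; `--supports` 23356)

The counterterm `𝒩_K` has a DIAGONAL `(+,−)` two-leg kernel `K(p_k⃗)/(2βV²)` (✓ `kernel_counterQuadratic_two_string/_offDiag`), so its raw two-leg position kernel factorises into a
volume-independent time factor and `conj` of the frame's position kernel `framePosKernel V K (x⃗₁ − x⃗₀)` (✓ `dualKernel_two_eq_of_diagonal`).  The frame position kernel is a
coefficient combination of eighth-weight lattice deltas at the harmonic shifts `(±m, ±n), (±n, ±m)` (`Lit/HubbardGridCounterQuadratic.framePosKernel_eq_sum`, `harmonicPosKernel_eq`);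
for `2·deg K < L` the centred lift `ι = Torus.proj (bL) ∘ Torus.cRep` maps the coarse shifts to the fine ones and is injective, so `Ǩ_{bL}(ι z) = Ǩ_L(z)`, and both kernels are even.

* §1 lattice facts: `cRepZ_natCast_of_two_mul_lt`, `cRepZ_neg_natCast_of_two_mul_lt`, `lift_harmonicShift`, `res_lift`, `lift_injective`, `harmonicShift_flip`;
* §2 `framePosKernel_lift` (`framePosKernel (bL) K (ι z) = framePosKernel L K z`, `2·deg K < L`), `framePosKernel_neg` (evenness);
* §3 `sectorisedKernel_two_counterQuadratic_eq` (the factorisation) and **`counterSeam_eq_zero_plus / _minus`** — the two seams of `hPc_of_truncReadout` are `0`.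

Bookkeeping on landed objects; nothing about the model is asserted; nothing asserts the (D) rows, (e), VL, K3 or superconductivity.
References: BGM 2003 §1.2 (2.10) [cite: BenfattoGiulianiMastropietro2003]; Salmhofer 1999 §4.2.4 (4.59).
-/

noncomputable section

namespace Summit.HubbardSuperconductivity.HubbardSuperconductivity.Theorems.TwoVolumeLip

set_option linter.dupNamespace false -- summit = problem name (single-conjunct summit), D-0017

open Finset Complex ComplexConjugate Literature.MathematicalPhysics.QuantumLattice GrassmannAlgebra Literature.Probability.LatticeModels
open Summit.HubbardSuperconductivity.HubbardSuperconductivity.Theorems.KLRegimeSplit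
open Summit.HubbardSuperconductivity.HubbardSuperconductivity.Theorems.KLProgrammeLegKernels
open Summit.HubbardSuperconductivity.HubbardSuperconductivity.Theorems.EngineV8
open Summit.HubbardSuperconductivity.HubbardSuperconductivity.Theorems.TwoVolumeDefect
open Summit.HubbardSuperconductivity.HubbardSuperconductivity.Theorems.TwoLegFourier

/-! ## §1 Lattice facts: centred lifts of the harmonic shifts -/

section Lattice

variable {L b : ℕ} [NeZero L] [NeZero (b * L)]

omit [NeZero L] [NeZero (b * L)] in
/-- The centred representative of a small natural residue is the natural itself: `cRepZ (m) = m` for `2m < L`. [folklore] -/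
theorem cRepZ_natCast_of_two_mul_lt {m : ℕ} (hm : 2 * m < L) : Torus.cRepZ ((m : ℕ) : ZMod L) = m := by
  have hval : (((m : ℕ) : ZMod L)).val = m := by rw [ZMod.val_natCast, Nat.mod_eq_of_lt (by omega)]
  rw [Torus.cRepZ, hval, if_pos (by omega)]

omit [NeZero (b * L)] in
/-- The centred representative of minus a small natural residue: `cRepZ (−m) = −m` for `2m < L`. [folklore] -/
theorem cRepZ_neg_natCast_of_two_mul_lt {m : ℕ} (hm : 2 * m < L) : Torus.cRepZ (-((m : ℕ) : ZMod L)) = -m := by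
  rcases Nat.eq_zero_or_pos m with rfl | hm0
  · simp [Torus.cRepZ]
  · have hval : (((m : ℕ) : ZMod L)).val = m := by rw [ZMod.val_natCast, Nat.mod_eq_of_lt (by omega)]
    have hne : ((m : ℕ) : ZMod L) ≠ 0 := by
      intro h
      have := congrArg ZMod.val h
      rw [hval, ZMod.val_zero] at this
      omega
    have hneg : (-((m : ℕ) : ZMod L)).val = L - m := by rw [ZMod.neg_val, if_neg hne, hval]
    rw [Torus.cRepZ, hneg, if_neg (by omega)]
    push_cast [Nat.cast_sub (by omega : m ≤ L)]
    ring

omit [NeZero (b * L)] in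
/-- **The centred lift maps the coarse harmonic shifts to the fine ones** (`2m < L`, `2n < L`). [folklore] -/
theorem lift_harmonicShift {m n : ℕ} (hm : 2 * m < L) (hn : 2 * n < L) (e : Fin 2 × Fin 2 × Fin 2) :
    Torus.proj (b * L) (Torus.cRep (harmonicShift L m n e)) = harmonicShift (b * L) m n e := by
  have key : ∀ (a : ℕ), 2 * a < L → ∀ s : Fin 2,
      (((Torus.cRepZ (if s = 0 then ((a : ℕ) : ZMod L) else -((a : ℕ) : ZMod L)) : ℤ)) : ZMod (b * L)) =
        (if s = 0 then ((a : ℕ) : ZMod (b * L)) else -((a : ℕ) : ZMod (b * L))) := by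
    intro a ha s
    by_cases hs : s = 0
    · rw [if_pos hs, if_pos hs, cRepZ_natCast_of_two_mul_lt ha, Int.cast_natCast]
    · rw [if_neg hs, if_neg hs, cRepZ_neg_natCast_of_two_mul_lt ha, Int.cast_neg, Int.cast_natCast]
  obtain ⟨s, t, w⟩ := e
  funext i
  rw [Torus.proj_apply, Torus.cRep]
  unfold harmonicShift
  dsimp only
  by_cases hw : w = 0
  · simp only [hw, if_true]
    fin_cases i
    · simp only [Fin.zero_eta, Matrix.cons_val_zero]; exact key m hm s
    · simp only [Fin.mk_one, Matrix.cons_val_one]; exact key n hn t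
  · simp only [hw, if_false]
    fin_cases i
    · simp only [Fin.zero_eta, Matrix.cons_val_zero]; exact key n hn s
    · simp only [Fin.mk_one, Matrix.cons_val_one]; exact key m hm t

/-- The residue of the centred lift is the identity: `res (ι z) = z`. [folklore] -/
theorem res_lift (z : TorusSite 2 L) (i : Fin 2) : ((((Torus.proj (b * L) (Torus.cRep z)) i).val : ℕ) : ZMod L) = z i := by
  have hdvd : L ∣ b * L := dvd_mul_left L b
  rw [← ZMod.cast_eq_val, ← ZMod.castHom_apply (h := hdvd) (R := ZMod L), Torus.proj_apply, map_intCast, Torus.cRep, Torus.intCast_cRepZ]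

/-- **The centred lift is injective.** [folklore] -/
theorem lift_injective : Function.Injective (fun z : TorusSite 2 L => Torus.proj (b * L) (Torus.cRep z)) := by
  intro z₁ z₂ h
  funext i
  have h1 := res_lift (L := L) (b := b) z₁ i
  have h2 := res_lift (L := L) (b := b) z₂ i
  have h' : Torus.proj (b * L) (Torus.cRep z₁) = Torus.proj (b * L) (Torus.cRep z₂) := h
  rw [h'] at h1
  exact h1.symm.trans h2

omit [NeZero L] [NeZero (b * L)] in
/-- Flipping both signs negates a harmonic shift. [folklore] -/
theorem harmonicShift_flip (m n : ℕ) (s t w : Fin 2) :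
    harmonicShift L m n (Equiv.swap 0 1 s, Equiv.swap 0 1 t, w) = -harmonicShift L m n (s, t, w) := by
  unfold harmonicShift
  dsimp only
  funext i
  fin_cases s <;> fin_cases t <;> fin_cases w <;> fin_cases i <;> simp [Equiv.swap_apply_left, Equiv.swap_apply_right]

end Lattice

/-! ## §2 The frame position kernel: invariance under the centred lift and evenness -/

section Frame

variable {L b : ℕ} [NeZero L] [NeZero (b * L)]

/-- **`Ǩ_{bL}(ι z) = Ǩ_L(z)` for `2·deg K < L`.** [cite: BenfattoGiulianiMastropietro2003, §1.2 The model (2.10)] -/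
theorem framePosKernel_lift (K : TrigPolyC4v) (hK : 2 * K.degree < L) (z : TorusSite 2 L) :
    framePosKernel (b * L) K (Torus.proj (b * L) (Torus.cRep z)) = framePosKernel L K z := by
  rw [framePosKernel_eq_sum, framePosKernel_eq_sum]
  refine sum_congr rfl fun m hm => sum_congr rfl fun n hn => ?_
  have hm' : 2 * m < L := by have := mem_range.1 hm; omega
  have hn' : 2 * n < L := by have := mem_range.1 hn; omega
  rw [harmonicPosKernel_eq, harmonicPosKernel_eq]
  refine congrArg (fun S : ℂ => (K.coeff m n : ℂ) * ((8 : ℂ)⁻¹ * S)) (sum_congr rfl fun e _ => ?_)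
  rw [← lift_harmonicShift (b := b) hm' hn' e]
  by_cases h : z = harmonicShift L m n e
  · rw [if_pos h, if_pos (by rw [h])]
  · rw [if_neg h, if_neg (fun h' => h (lift_injective (L := L) (b := b) h'))]

omit [NeZero (b * L)] in
/-- **The frame position kernel is even**: `Ǩ_L(−z) = Ǩ_L(z)`. [cite: BenfattoGiulianiMastropietro2003, §1.2 The model (2.10)] -/
theorem framePosKernel_neg (K : TrigPolyC4v) (z : TorusSite 2 L) : framePosKernel L K (-z) = framePosKernel L K z := by
  rw [framePosKernel_eq_sum, framePosKernel_eq_sum]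
  refine sum_congr rfl fun m _ => sum_congr rfl fun n _ => ?_
  rw [harmonicPosKernel_eq, harmonicPosKernel_eq]
  refine congrArg (fun S : ℂ => (K.coeff m n : ℂ) * ((8 : ℂ)⁻¹ * S)) ?_
  -- reindex the eight shifts by the sign flip
  let φ : Fin 2 × Fin 2 × Fin 2 ≃ Fin 2 × Fin 2 × Fin 2 :=
    (Equiv.swap (0 : Fin 2) 1).prodCongr ((Equiv.swap (0 : Fin 2) 1).prodCongr (Equiv.refl _))
  rw [← Equiv.sum_comp φ]
  refine sum_congr rfl fun e _ => ?_
  obtain ⟨s, t, w⟩ := e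
  show (if -z = harmonicShift L m n (Equiv.swap 0 1 s, Equiv.swap 0 1 t, w) then (1 : ℂ) else 0) = if z = harmonicShift L m n (s, t, w) then 1 else 0
  have hiff : (-z = harmonicShift L m n (Equiv.swap 0 1 s, Equiv.swap 0 1 t, w)) ↔ (z = harmonicShift L m n (s, t, w)) := by
    rw [harmonicShift_flip, neg_inj]
  by_cases h : z = harmonicShift L m n (s, t, w)
  · rw [if_pos h, if_pos (hiff.2 h)]
  · rw [if_neg h, if_neg (fun h' => h (hiff.1 h'))]

end Frame

/-! ## §3 The counterterm's raw two-leg kernel factorises; the seams vanish -/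

section Seam

variable {V M : ℕ} [NeZero V]

/-- `Σ_q (K(p_q)/(βV²)) χ_q(z) = β⁻¹ · conj Ǩ_V(z)`. [cite: BenfattoGiulianiMastropietro2003, §1.2 The model (2.10)] -/
theorem sum_eval_div_mul_torusChar_eq (β : ℝ) (K : TrigPolyC4v) (z : TorusSite 2 V) :
    ∑ q : TorusSite 2 V, (((K.eval (latticeMomentum V q) / (β * (V : ℝ) ^ 2) : ℝ)) : ℂ) * torusChar q z =
      ((β : ℂ))⁻¹ * conj (framePosKernel V K z) := by
  rw [framePosKernel, map_mul, map_inv₀, map_pow, map_natCast, map_sum, mul_sum, mul_sum]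
  refine sum_congr rfl fun q _ => ?_
  rw [map_mul, Complex.conj_ofReal, Complex.conj_conj]
  push_cast
  ring

/-- **The raw two-leg position kernel of the counterterm**: `W^V(𝒩_K) 2 Ω_σ (x₀, x₁) = (Σ_{k₀} e^{iω_{k₀}(τ₁−τ₀)}) · (2!)⁻¹ · β⁻¹ · conj Ǩ_V(x⃗₁ − x⃗₀)` — a volume-free time factor times the
frame's position kernel. [cite: BenfattoGiulianiMastropietro2003, §1.2 The model (2.10)] -/
theorem sectorisedKernel_two_counterQuadratic_eq [NeZero M] (β : ℝ) (K : TrigPolyC4v) (σ : Fin 2) (x₀ x₁ : SpaceTimeIdx V M) :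
    sectorisedKernel V M β (trivialMultiplier V M) (counterQuadratic V M β K) 2 (![((0, σ), 0), ((0, σ), 1)] : Fin 2 → SectorLeg 1) ![x₀, x₁] =
      (∑ k₀ : MatsubaraIdx M, Complex.exp (((matsubaraFreq β M k₀ * (imagTime β M x₁.1 - imagTime β M x₀.1) : ℝ) : ℂ) * I)) *
        ((((2 : ℕ).factorial : ℚ)⁻¹ • (1 : ℂ)) * (((β : ℂ))⁻¹ * conj (framePosKernel V K (x₁.2 - x₀.2)))) := by
  rw [dualKernel_two_eq_of_diagonal β _ σ (fun k k' hk => kernel_counterQuadratic_two_offDiag β K σ hk) x₀ x₁, Fintype.sum_prod_type, sum_mul]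
  refine sum_congr rfl fun k₀ _ => ?_
  have h : ∀ q : TorusSite 2 V, kernel ℂ (counterQuadratic V M β K) 2 (![(((k₀, q), σ), 0), (((k₀, q), σ), 1)] : Fin 2 → HubbardFieldIdx V M) *
      (Complex.exp (((matsubaraFreq β M k₀ * (imagTime β M x₁.1 - imagTime β M x₀.1) : ℝ) : ℂ) * I) * torusChar q (x₁.2 - x₀.2)) =
      Complex.exp (((matsubaraFreq β M k₀ * (imagTime β M x₁.1 - imagTime β M x₀.1) : ℝ) : ℂ) * I) * ((((2 : ℕ).factorial : ℚ)⁻¹ • (1 : ℂ)) *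
        ((((K.eval (latticeMomentum V q) / (β * (V : ℝ) ^ 2) : ℝ)) : ℂ) * torusChar q (x₁.2 - x₀.2))) := by
    intro q
    rw [kernel_counterQuadratic_two_string]
    ring
  rw [sum_congr rfl fun q _ => h q, ← mul_sum, ← mul_sum, sum_eval_div_mul_torusChar_eq]

variable {L b : ℕ} [NeZero L] [NeZero (b * L)] [NeZero M]

/-- **THE `+` SEAM VANISHES** (`2·deg K < L`): at a fine pin `of`, `oc := res of`, every `t₁, ȳ`:
`W^{L}(𝒩_K)(oc; t₁, res of.2 + ȳ) = W^{bL}(𝒩_K)(of; t₁, of.2 + ι ȳ)`. [cite: BenfattoGiulianiMastropietro2003, §1.2 The model (2.10)] -/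
theorem counterSeam_term_eq_plus (β : ℝ) {K : TrigPolyC4v} (hK : 2 * K.degree < L) (σ : Fin 2) (of : SpaceTimeIdx (b * L) M) (t₁ : ImagTimeIdx M)
    (ybar : TorusSite 2 L) :
    sectorisedKernel L M β (trivialMultiplier L M) (counterQuadratic L M β K) 2 (![((0, σ), 0), ((0, σ), 1)] : Fin 2 → SectorLeg 1)
        ![(of.1, fun i => (((of.2 i).val : ℕ) : ZMod L)), (t₁, (fun i => (((of.2 i).val : ℕ) : ZMod L)) + ybar)] =
      sectorisedKernel (b * L) M β (trivialMultiplier (b * L) M) (counterQuadratic (b * L) M β K) 2 (![((0, σ), 0), ((0, σ), 1)] : Fin 2 → SectorLeg 1)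
        ![of, (t₁, of.2 + Torus.proj (b * L) (Torus.cRep ybar))] := by
  rw [sectorisedKernel_two_counterQuadratic_eq, sectorisedKernel_two_counterQuadratic_eq]
  dsimp only
  rw [add_sub_cancel_left, add_sub_cancel_left, framePosKernel_lift K hK]

/-- **THE `−` SEAM VANISHES** (`2·deg K < L`): `W^{L}(𝒩_K)(oc; t₁, res of.2 − ȳ) = W^{bL}(𝒩_K)(of; t₁, of.2 − ι ȳ)` (evenness of `Ǩ`).
[cite: BenfattoGiulianiMastropietro2003, §1.2 The model (2.10)] -/
theorem counterSeam_term_eq_minus (β : ℝ) {K : TrigPolyC4v} (hK : 2 * K.degree < L) (σ : Fin 2) (of : SpaceTimeIdx (b * L) M) (t₁ : ImagTimeIdx M)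
    (ybar : TorusSite 2 L) :
    sectorisedKernel L M β (trivialMultiplier L M) (counterQuadratic L M β K) 2 (![((0, σ), 0), ((0, σ), 1)] : Fin 2 → SectorLeg 1)
        ![(of.1, fun i => (((of.2 i).val : ℕ) : ZMod L)), (t₁, (fun i => (((of.2 i).val : ℕ) : ZMod L)) + -ybar)] =
      sectorisedKernel (b * L) M β (trivialMultiplier (b * L) M) (counterQuadratic (b * L) M β K) 2 (![((0, σ), 0), ((0, σ), 1)] : Fin 2 → SectorLeg 1)
        ![of, (t₁, of.2 + -Torus.proj (b * L) (Torus.cRep ybar))] := by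
  rw [sectorisedKernel_two_counterQuadratic_eq, sectorisedKernel_two_counterQuadratic_eq]
  dsimp only
  rw [add_sub_cancel_left, add_sub_cancel_left, framePosKernel_neg, framePosKernel_neg, framePosKernel_lift K hK]

/-- **The `+` seam of `hPc_of_truncReadout` is zero** (`2·deg K < L`). -/
theorem counterSeam_sum_eq_zero_plus (β : ℝ) {K : TrigPolyC4v} (hK : 2 * K.degree < L) (σ : Fin 2) (of : SpaceTimeIdx (b * L) M) :
    ∑ t₁ : ImagTimeIdx M, ∑ ybar : TorusSite 2 L,
        ‖sectorisedKernel L M β (trivialMultiplier L M) (counterQuadratic L M β K) 2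
              (![((0, σ), 0), ((0, σ), 1)] : Fin 2 → SectorLeg 1)
              ![(of.1, fun i => (((of.2 i).val : ℕ) : ZMod L)), (t₁, (fun i => (((of.2 i).val : ℕ) : ZMod L)) + ybar)] -
            sectorisedKernel (b * L) M β (trivialMultiplier (b * L) M) (counterQuadratic (b * L) M β K) 2
              (![((0, σ), 0), ((0, σ), 1)] : Fin 2 → SectorLeg 1) ![of, (t₁, of.2 + Torus.proj (b * L) (Torus.cRep ybar))]‖ = 0 :=
  sum_eq_zero fun t₁ _ => sum_eq_zero fun ybar _ => by rw [counterSeam_term_eq_plus β hK σ of t₁ ybar, sub_self, norm_zero]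

/-- **The `−` seam of `hPc_of_truncReadout` is zero** (`2·deg K < L`). -/
theorem counterSeam_sum_eq_zero_minus (β : ℝ) {K : TrigPolyC4v} (hK : 2 * K.degree < L) (σ : Fin 2) (of : SpaceTimeIdx (b * L) M) :
    ∑ t₁ : ImagTimeIdx M, ∑ ybar : TorusSite 2 L,
        ‖sectorisedKernel L M β (trivialMultiplier L M) (counterQuadratic L M β K) 2
              (![((0, σ), 0), ((0, σ), 1)] : Fin 2 → SectorLeg 1)
              ![(of.1, fun i => (((of.2 i).val : ℕ) : ZMod L)), (t₁, (fun i => (((of.2 i).val : ℕ) : ZMod L)) + -ybar)] -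
            sectorisedKernel (b * L) M β (trivialMultiplier (b * L) M) (counterQuadratic (b * L) M β K) 2
              (![((0, σ), 0), ((0, σ), 1)] : Fin 2 → SectorLeg 1) ![of, (t₁, of.2 + -Torus.proj (b * L) (Torus.cRep ybar))]‖ = 0 :=
  sum_eq_zero fun t₁ _ => sum_eq_zero fun ybar _ => by rw [counterSeam_term_eq_minus β hK σ of t₁ ybar, sub_self, norm_zero]

end Seam

end Summit.HubbardSuperconductivity.HubbardSuperconductivity.Theorems.TwoVolumeLip

end
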